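import Summits.BirchSwinnertonDyer.BirchSwinnertonDyer.Theses.InertBadSignedBranches
import Summits.BirchSwinnertonDyer.BirchSwinnertonDyer.Theorems.InertBadSignedBranchesInertBadAtThreeIstarZeroOfPublishedFacts
import HarnessLib

/-!
# Route `InertBadSignedBranches` (rung K8), D71 child `InertBadAtThreeIstarZero`: the child FROM the
# three reading heads of the route's readings item stated for ODD `p` (guard `5 ≤ p` ↦ `p ≠ 2`), the
# law at `3`, and `PublishedFactsInert` (helper toward stmt-BirchSwinnertonDyer-19656; cell `bsd-cm`,
# seat `bsd-cm-k8i-c41`; theorems only, nothing asserted)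

HONEST FRAMING (cell `bsd-cm`, run/shared/lean/pub/bsd-cm/): Birch–Swinnerton-Dyer is NOT proved by
any of this. The item `InertBadAtThreeIstarZero` — the `3`-part of the BSD formula for every globally
minimal CM curve `W/ℚ` of signed local type `(3, I₀*)` and analytic rank one — is OPEN in print; every
theorem below is CONDITIONAL on displayed hypotheses; the class served (O10-PS@3, 57 classes
`N < 5·10⁵`) stays CONSTRUCTION-SHAPED and OPEN. THEOREMS ONLY: 0 definitions, 0 named facts minted,
0 `sorry`; no label or mark moves.

PARTITION (D-0054): CornerF inert-bad (B12 / O10) × O10-PS@3 (57 rank-one classes of signed local type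
`(3, I₀*)`) × `p = 3` — types-the-object-of; closes no cell, books nothing.

## The point of this file (one sentence for the planner)

The planner's by-name split of the readings item `PrintReadingsInert` (D79 (1) turnkey,
HOME/bsd-cm-plan/g13/k8readings/Sketch.lean: heads `PlusMainConjectureCMInertGood`,
`StrictMinusNoFiniteSubmoduleOnType`, `ExactReadingOnType`, each guarded `5 ≤ p →`) has a `p`-uniform
variant: the SAME three heads with the guard `5 ≤ p →` replaced by `p ≠ 2 →` (Kobayashi 2003,
Kitajima–Otsuki 2018 and Pollack–Rubin 2004 are all stated for ODD `p` with `a_p = 0` / good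
supersingular reduction, so the odd-`p` heads have the print tier of the `p ≥ 5` heads). THIS FILE
proves that the odd-`p` heads, instantiated at `p = 3` (where `p* = (−1)^{⌊3/2⌋}·3 = −3` and the period
clause reads through `¬ Even (3 / 2)`: imaginary period / `minusPeriod`), are EXACTLY the readings
binder of the x1b / inert `p = 3` nodes — so ONE set of three reading items would serve both the
`p ≥ 5` branch (restriction to `5 ≤ p`, the planner's glue verbatim) and the D71 child at `3`:
**`InertBadAtThreeIstarZero` ⟸ law@3 ∧ the three odd-`p` heads ∧ `PublishedFactsInert`**, law in
either kernel normal form of record (pair/LEVEL = the crux body read at `3`; print/LOG = (GZ_η-VAL)@3).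
Nothing here files or reshapes an item (D-0014): it is evidence for the planner's choice of guard.

## What is here

* `inertBadSignedBranches_readingsAtThree_of_oddHeads` — (C1_η)@3 ∧ (for every `W` of type `(3, I₀*)`
  with `r_an = 1`: (R2)@3 ∧ the exact Kobayashi-7.4 (ii) reading at `3`) — the binder `h₅` of x1b's
  `inertBadSignedBranches_inertBadAtThreeIstarZero_of_{pairLaw,etaGZValuation}AtThree_of_readingsAtThree`
  — FROM the three odd-`p` heads;
* `inertBadSignedBranches_inertBadAtThreeIstarZero_of_pairLawAtThree_of_oddHeads` — THE ITEM (fully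
  qualified route type) ⟸ C-cc-1@3 in pair/LEVEL form ∧ odd-`p` heads ∧ `PublishedFactsInert`;
* `inertBadSignedBranches_inertBadAtThreeIstarZero_of_etaGZValuationAtThree_of_oddHeads` — the same
  with the law in print/LOG currency (GZ_η-VAL)@3.

References (locators only): [Kobayashi2003] §4 (p. 8), Thm. 7.4 (p. 13); [KitajimaOtsuki2018] Main
Thm. 1.3 (= Thm. 4.8), Def. 2.1; [PollackRubin2004] p. 447 (standing hypothesis `p > 2`), p. 448
(Theorem and remark); [Mazur1978] Cor. 4.1; [SilvermanATAEC1994] IV.9.4, Table 4.1; [Miller2011LMS]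
§1, Def. 1.1.
-/

set_option autoImplicit false
set_option linter.dupNamespace false

noncomputable section

open scoped Classical MatrixGroups ModularForm NumberField

open CongruenceSubgroup Field NumberField IsDedekindDomain IsDedekindDomain.HeightOneSpectrum
  WeierstrassCurve Rat.HeightOneSpectrum
open Literature.NumberTheory.EllipticCurves
open Literature.NumberTheory.EllipticCurves.ModularForms
open Literature.NumberTheory.EllipticCurves.Kobayashi2003 hiding IsQuadraticBranchMinusLFunction
open Literature.NumberTheory.EllipticCurves.Rank1Residual
open Literature.NumberTheory.EllipticCurves.Rank1Residual.Typed
open Literature.NumberTheory.GaloisRepresentations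
open Literature.NumberTheory.GaloisCohomology
open Summit.BirchSwinnertonDyer.Rank1Residual
open Summit.BirchSwinnertonDyer.Rank1Residual.Additive
open Summit.BirchSwinnertonDyer.Rank1Residual.Additive.LocalLog
open Summit.BirchSwinnertonDyer.Rank1Residual.X12.O10
open Summit.BirchSwinnertonDyer.BirchSwinnertonDyer.Theses.InertBadSignedBranches
open Summit.BirchSwinnertonDyer.BirchSwinnertonDyer.Theorems.InertBadOdd

namespace Summit.BirchSwinnertonDyer.BirchSwinnertonDyer.Theorems

/-- **The readings binder at `3` FROM the three reading heads stated for ODD `p`.** Hypotheses: `h1` =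
(C1_η) for every CM good-inert `V` at every odd `p` (the head `PlusMainConjectureCMInertGood` with guard
`p ≠ 2`; Pollack–Rubin's remark, `p > 2`; conjecture-grade typed input), `h2` = (R2) on the type
`(p, I₀*)` at every odd `p` (head `StrictMinusNoFiniteSubmoduleOnType`, guard `p ≠ 2`; Kitajima–Otsuki
2018 READ on the strict-minus datum), `h3` = Kobayashi 2003 Thm. 7.4 (ii) EXACT on the type at every
odd `p` (head `ExactReadingOnType`, guard `p ≠ 2`). Conclusion: the `p = 3` binder `h₅` of the x1b /
inert `p = 3` nodes — (C1_η)@3 ∧ ((R2)@3 ∧ exact reading at `3` for every `W` of type `(3, I₀*)` with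
`r_an = 1`), twist parameter `−3`, imaginary period. Pure instantiation (`(−1)^{⌊3/2⌋}·3 = −3` by
`norm_num`, `¬ Even (3 / 2)` by `decide`). CONDITIONAL; nothing about the printed theorems is asserted.
[cite: Kobayashi2003, §4 (p. 8), Thm. 7.4 (p. 13)] [cite: KitajimaOtsuki2018, Main Thm. 1.3 with Def. 2.1]
[cite: PollackRubin2004, p. 448 (Theorem and remark)] -/
theorem inertBadSignedBranches_readingsAtThree_of_oddHeads
    (h1 : ∀ (p : ℕ) [Fact p.Prime], p ≠ 2 → ∀ (V : WeierstrassCurve ℚ) [V.IsElliptic]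
      [V.IsGloballyMinimal], V.HasCM → V.HasGoodReductionAtPrime p → CMInert V p →
      QuadraticBranchPlusMainConjectureAt V p)
    (h2 : ∀ (p : ℕ) [Fact p.Prime], p ≠ 2 → ∀ (W : WeierstrassCurve ℚ) [W.IsElliptic]
      [W.IsGloballyMinimal], HasSignedLocalType W p (.Istar 0) → W.analyticRank = 1 →
      OddBranchStrictMinusNoFiniteSubmoduleAt W p)
    (h3 : ∀ (p : ℕ) [Fact p.Prime], p ≠ 2 → ∀ (W : WeierstrassCurve ℚ) [W.IsElliptic]
      [W.IsGloballyMinimal], HasSignedLocalType W p (.Istar 0) → W.analyticRank = 1 →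
      ∀ (V : WeierstrassCurve ℚ) [V.IsElliptic] [V.IsGloballyMinimal] (C : VariableChange ℚ)
        {N : ℕ} [NeZero N] {f : CuspForm (Gamma0 N) 2},
        p ≠ 2 → C • W.quadraticTwist ((-1) ^ (p / 2) * p) = V →
        V.HasGoodReductionAtPrime p → V.frobeniusTrace p = 0 →
        QuadraticBranchPlusMainConjectureAt V p → IsNewformOf V f →
        ∀ (ϖ : ℚ), (if Even (p / 2) then (ϖ : ℝ) * V.realPeriodRat = plusPeriod f
            else (ϖ : ℝ) * V.imaginaryPeriodRat = minusPeriod f) →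
        ∀ (Lη : IwasawaAlgebra p), IsQuadraticBranchMinusLFunction f p ϖ Lη →
        ∀ (κ : ZpExtension ℚ p) (γ : Field.absoluteGaloisGroup ℚ),
          κ.IsCyclotomic → κ.IsTopGenerator γ → IsCyclotomicVariable p γ →
        ∀ (D : StrictSignedSelmerDualData W κ ℚ_[p] γ (-1)) (L' : IwasawaAlgebra p),
          Lη = PowerSeries.X * L' → D.charIdeal = Ideal.span {L'}) :
    (∀ (V : WeierstrassCurve ℚ) [V.IsElliptic] [V.IsGloballyMinimal], V.HasCM →
        V.HasGoodReductionAtPrime 3 → CMInert V 3 → QuadraticBranchPlusMainConjectureAt V 3) ∧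
      ∀ (W : WeierstrassCurve ℚ) [W.IsElliptic] [W.IsGloballyMinimal],
        HasSignedLocalType W 3 (.Istar 0) → W.analyticRank = 1 →
        OddBranchStrictMinusNoFiniteSubmoduleAt W 3 ∧
        ∀ (V : WeierstrassCurve ℚ) [V.IsElliptic] [V.IsGloballyMinimal] (C : VariableChange ℚ)
          {N : ℕ} [NeZero N] {f : CuspForm (Gamma0 N) 2},
          (3 : ℕ) ≠ 2 → C • W.quadraticTwist (-3) = V →
          V.HasGoodReductionAtPrime 3 → V.frobeniusTrace 3 = 0 →
          QuadraticBranchPlusMainConjectureAt V 3 → IsNewformOf V f →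
          ∀ (ϖ : ℚ), (ϖ : ℝ) * V.imaginaryPeriodRat = minusPeriod f →
          ∀ (Lη : IwasawaAlgebra 3), IsQuadraticBranchMinusLFunction f 3 ϖ Lη →
          ∀ (κ : ZpExtension ℚ 3) (γ : Field.absoluteGaloisGroup ℚ),
            κ.IsCyclotomic → κ.IsTopGenerator γ → IsCyclotomicVariable 3 γ →
          ∀ (D : StrictSignedSelmerDualData W κ ℚ_[3] γ (-1)) (L' : IwasawaAlgebra 3),
            Lη = PowerSeries.X * L' → D.charIdeal = Ideal.span {L'} := by
  have h32 : ((-1 : ℚ) ^ (3 / 2) * (3 : ℕ)) = -3 := by norm_num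
  have hodd : ¬ Even (3 / 2) := by decide
  refine ⟨fun V _ _ hCM hgood hin ↦ h1 3 (by decide) V hCM hgood hin, fun W _ _ hT hr ↦ ⟨?_, ?_⟩⟩
  · exact h2 3 (by decide) W hT hr
  · intro V _ _ C N _ f hp2 hC hgood hap hC1 hf ϖ hϖ Lη hL κ γ hκ hγ hγc D L' hLL'
    rw [← h32] at hC
    exact h3 3 (by decide) W hT hr V C hp2 hC hgood hap hC1 hf ϖ (by rw [if_neg hodd]; exact hϖ)
      Lη hL κ γ hκ hγ hγc D L' hLL'

/-- **THE D71 CHILD `InertBadAtThreeIstarZero` MODULO C-cc-1@3 (pair/LEVEL form) ∧ the three odd-`p`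
reading heads ∧ the route's support item `PublishedFactsInert`.** `hlaw₃` = the route crux
`CccOneLawOnTypeIstarZero`'s unfolded body READ AT `3` in the `+ δ`-free normal form of record
(`ord₃ c₃(W) = 0` inlined; a guard-free typed C-cc-1 item with `+ δ` instantiates it by `add_zero`,
referee NIT-K8P3-2); `h1`/`h2`/`h3` = the readings heads for odd `p` (previous theorem); `h₆` =
`PublishedFactsInert` verbatim (`ord₃ c₃(W) = 0` and the period datum at `3` discharged inside by the
inert / x1b lemmas). Composition of `inertBadSignedBranches_readingsAtThree_of_oddHeads` with x1b's
`inertBadSignedBranches_inertBadAtThreeIstarZero_of_pairLawAtThree_of_readingsAtThree`. CONDITIONAL on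
every displayed hypothesis; the item stays OPEN; nothing booked. [cite: Kobayashi2003, §4 (p. 8), Thm. 7.4 (p. 13)]
[cite: KitajimaOtsuki2018, Main Thm. 1.3 (arXiv:1607.03612 p. 3)] [cite: PollackRubin2004, p. 448 (remark)]
[cite: Mazur1978, Cor. 4.1] [cite: SilvermanATAEC1994, IV.9.4 and Table 4.1] [cite: Miller2011LMS, §1 and Def. 1.1] -/
theorem inertBadSignedBranches_inertBadAtThreeIstarZero_of_pairLawAtThree_of_oddHeads
    (hlaw₃ : ∀ (W : WeierstrassCurve ℚ) [W.IsElliptic] [W.IsGloballyMinimal],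
      HasSignedLocalType W 3 (.Istar 0) → W.analyticRank = 1 →
      ∀ (V : WeierstrassCurve ℚ) [V.IsElliptic] [V.IsGloballyMinimal] (C : VariableChange ℚ)
        {N : ℕ} [NeZero N] {f : CuspForm (Gamma0 N) 2},
        C • W.quadraticTwist (-3) = V →
        V.HasGoodReductionAtPrime 3 → V.frobeniusTrace 3 = 0 → IsNewformOf V f →
        ∀ (ϖ : ℚ), (ϖ : ℝ) * V.imaginaryPeriodRat = minusPeriod f →
        ∀ (L : IwasawaAlgebra 3), IsQuadraticBranchMinusLFunction f 3 ϖ L →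
        (∀ Q : (W.baseChange ℚ_[3]).toAffine.Point, 3 • Q = 0 → Q = 0) →
        ∀ (P : W.toAffine.Point) (n : ℕ), ¬ IsOfFinAddOrder P →
        (∀ R : W.toAffine.Point, ∃ (k : ℤ) (T : W.toAffine.Point), IsOfFinAddOrder T ∧ R = k • P + T) →
        (∃ Q : (W.baseChange ℚ_[3]).toAffine.Point, 3 ^ n • Q = W.toPadicPoint 3 P) →
        (∀ Q : (W.baseChange ℚ_[3]).toAffine.Point, 3 ^ (n + 1) • Q ≠ W.toPadicPoint 3 P) →
        ∀ (q : ℚ), shaAn W = (q : ℂ) →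
        PowerSeries.coeff 1 L ≠ 0 ∧
          ((PowerSeries.coeff 1 L : ℤ_[3]) : ℚ_[3]).valuation =
            2 * (n : ℤ) + padicValRat 3 (q * W.tamagawaProduct / (W.torsionOrder : ℚ) ^ 2))
    (h1 : ∀ (p : ℕ) [Fact p.Prime], p ≠ 2 → ∀ (V : WeierstrassCurve ℚ) [V.IsElliptic]
      [V.IsGloballyMinimal], V.HasCM → V.HasGoodReductionAtPrime p → CMInert V p →
      QuadraticBranchPlusMainConjectureAt V p)
    (h2 : ∀ (p : ℕ) [Fact p.Prime], p ≠ 2 → ∀ (W : WeierstrassCurve ℚ) [W.IsElliptic]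
      [W.IsGloballyMinimal], HasSignedLocalType W p (.Istar 0) → W.analyticRank = 1 →
      OddBranchStrictMinusNoFiniteSubmoduleAt W p)
    (h3 : ∀ (p : ℕ) [Fact p.Prime], p ≠ 2 → ∀ (W : WeierstrassCurve ℚ) [W.IsElliptic]
      [W.IsGloballyMinimal], HasSignedLocalType W p (.Istar 0) → W.analyticRank = 1 →
      ∀ (V : WeierstrassCurve ℚ) [V.IsElliptic] [V.IsGloballyMinimal] (C : VariableChange ℚ)
        {N : ℕ} [NeZero N] {f : CuspForm (Gamma0 N) 2},
        p ≠ 2 → C • W.quadraticTwist ((-1) ^ (p / 2) * p) = V →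
        V.HasGoodReductionAtPrime p → V.frobeniusTrace p = 0 →
        QuadraticBranchPlusMainConjectureAt V p → IsNewformOf V f →
        ∀ (ϖ : ℚ), (if Even (p / 2) then (ϖ : ℝ) * V.realPeriodRat = plusPeriod f
            else (ϖ : ℝ) * V.imaginaryPeriodRat = minusPeriod f) →
        ∀ (Lη : IwasawaAlgebra p), IsQuadraticBranchMinusLFunction f p ϖ Lη →
        ∀ (κ : ZpExtension ℚ p) (γ : Field.absoluteGaloisGroup ℚ),
          κ.IsCyclotomic → κ.IsTopGenerator γ → IsCyclotomicVariable p γ →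
        ∀ (D : StrictSignedSelmerDualData W κ ℚ_[p] γ (-1)) (L' : IwasawaAlgebra p),
          Lη = PowerSeries.X * L' → D.charIdeal = Ideal.span {L'})
    (h₆ : PublishedFactsInert) :
    Summit.BirchSwinnertonDyer.BirchSwinnertonDyer.Theses.InertBadSignedBranches.InertBadAtThreeIstarZero := by
  unfold Summit.BirchSwinnertonDyer.BirchSwinnertonDyer.Theses.InertBadSignedBranches.InertBadAtThreeIstarZero
  intro W _ _ _ hT hr
  exact inertBadSignedBranches_inertBadAtThreeIstarZero_of_pairLawAtThree_of_readingsAtThree hlaw₃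
    (inertBadSignedBranches_readingsAtThree_of_oddHeads h1 h2 h3) h₆ W hT hr

/-- **THE D71 CHILD `InertBadAtThreeIstarZero` MODULO (GZ_η-VAL)@3 (print/LOG form) ∧ the three odd-`p`
reading heads ∧ `PublishedFactsInert`** — the same with the law in print currency: `hGZη₃` =
`coeff₁ L ≠ 0 ∧ v₃(coeff₁ L) = 2·ord₃ log_ω(P) + ord₃(L′(W,1)/(Ω_W·Reg W))` on the type (the cell's own
statement, PAPER from (GZ_η)@3 — NO print; a HYPOTHESIS). Composition with x1b's
`inertBadSignedBranches_inertBadAtThreeIstarZero_of_etaGZValuationAtThree_of_readingsAtThree`.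
CONDITIONAL; the item stays OPEN; nothing booked. [cite: Kobayashi2003, §4 (p. 8), Thm. 7.4 (p. 13)]
[cite: KitajimaOtsuki2018, Main Thm. 1.3 (arXiv:1607.03612 p. 3)] [cite: PollackRubin2004, p. 448 (remark)]
[cite: Mazur1978, Cor. 4.1] [cite: SilvermanAEC2009, IV.6.4 and VII.6.3]
[cite: SilvermanATAEC1994, IV.9.4 and Table 4.1] [cite: Miller2011LMS, §1 and Def. 1.1] -/
theorem inertBadSignedBranches_inertBadAtThreeIstarZero_of_etaGZValuationAtThree_of_oddHeads
    (hGZη₃ : ∀ (W : WeierstrassCurve ℚ) [W.IsElliptic] [W.IsGloballyMinimal],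
      HasSignedLocalType W 3 (.Istar 0) → W.analyticRank = 1 →
      ∀ (V : WeierstrassCurve ℚ) [V.IsElliptic] [V.IsGloballyMinimal] (C : VariableChange ℚ)
        {N : ℕ} [NeZero N] {f : CuspForm (Gamma0 N) 2},
        C • W.quadraticTwist (-3) = V →
        V.HasGoodReductionAtPrime 3 → V.frobeniusTrace 3 = 0 → IsNewformOf V f →
        ∀ (ϖ : ℚ), (ϖ : ℝ) * V.imaginaryPeriodRat = minusPeriod f →
        ∀ (L : IwasawaAlgebra 3), IsQuadraticBranchMinusLFunction f 3 ϖ L →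
        ∀ (P : W.toAffine.Point), ¬ IsOfFinAddOrder P →
        (∀ R : W.toAffine.Point, ∃ (k : ℤ) (T : W.toAffine.Point), IsOfFinAddOrder T ∧ R = k • P + T) →
        ∀ (q : ℚ), W.leadingLCoeff / ((W.realPeriodRat * W.regulator : ℝ) : ℂ) = (q : ℂ) →
        PowerSeries.coeff 1 L ≠ 0 ∧
          ((PowerSeries.coeff 1 L : ℤ_[3]) : ℚ_[3]).valuation =
            2 * (padicLog (W.baseChange ℚ_[3]) (W.toPadicPoint 3 P)).valuation + padicValRat 3 q)
    (h1 : ∀ (p : ℕ) [Fact p.Prime], p ≠ 2 → ∀ (V : WeierstrassCurve ℚ) [V.IsElliptic]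
      [V.IsGloballyMinimal], V.HasCM → V.HasGoodReductionAtPrime p → CMInert V p →
      QuadraticBranchPlusMainConjectureAt V p)
    (h2 : ∀ (p : ℕ) [Fact p.Prime], p ≠ 2 → ∀ (W : WeierstrassCurve ℚ) [W.IsElliptic]
      [W.IsGloballyMinimal], HasSignedLocalType W p (.Istar 0) → W.analyticRank = 1 →
      OddBranchStrictMinusNoFiniteSubmoduleAt W p)
    (h3 : ∀ (p : ℕ) [Fact p.Prime], p ≠ 2 → ∀ (W : WeierstrassCurve ℚ) [W.IsElliptic]
      [W.IsGloballyMinimal], HasSignedLocalType W p (.Istar 0) → W.analyticRank = 1 →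
      ∀ (V : WeierstrassCurve ℚ) [V.IsElliptic] [V.IsGloballyMinimal] (C : VariableChange ℚ)
        {N : ℕ} [NeZero N] {f : CuspForm (Gamma0 N) 2},
        p ≠ 2 → C • W.quadraticTwist ((-1) ^ (p / 2) * p) = V →
        V.HasGoodReductionAtPrime p → V.frobeniusTrace p = 0 →
        QuadraticBranchPlusMainConjectureAt V p → IsNewformOf V f →
        ∀ (ϖ : ℚ), (if Even (p / 2) then (ϖ : ℝ) * V.realPeriodRat = plusPeriod f
            else (ϖ : ℝ) * V.imaginaryPeriodRat = minusPeriod f) →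
        ∀ (Lη : IwasawaAlgebra p), IsQuadraticBranchMinusLFunction f p ϖ Lη →
        ∀ (κ : ZpExtension ℚ p) (γ : Field.absoluteGaloisGroup ℚ),
          κ.IsCyclotomic → κ.IsTopGenerator γ → IsCyclotomicVariable p γ →
        ∀ (D : StrictSignedSelmerDualData W κ ℚ_[p] γ (-1)) (L' : IwasawaAlgebra p),
          Lη = PowerSeries.X * L' → D.charIdeal = Ideal.span {L'})
    (h₆ : PublishedFactsInert) :
    Summit.BirchSwinnertonDyer.BirchSwinnertonDyer.Theses.InertBadSignedBranches.InertBadAtThreeIstarZero := by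
  unfold Summit.BirchSwinnertonDyer.BirchSwinnertonDyer.Theses.InertBadSignedBranches.InertBadAtThreeIstarZero
  intro W _ _ _ hT hr
  exact inertBadSignedBranches_inertBadAtThreeIstarZero_of_etaGZValuationAtThree_of_readingsAtThree hGZη₃
    (inertBadSignedBranches_readingsAtThree_of_oddHeads h1 h2 h3) h₆ W hT hr

end Summit.BirchSwinnertonDyer.BirchSwinnertonDyer.Theorems

end
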